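import Summits.BirchSwinnertonDyer.BirchSwinnertonDyer.Theorems.ManinLocalTwoThreeKummerValuesScaledModel
import Summits.BirchSwinnertonDyer.BirchSwinnertonDyer.Theorems.ManinLocalTwoThreeCDivisionIntegralCDT
import Summits.BirchSwinnertonDyer.Rank1Residual.ManinConstantOne
import Summits.BirchSwinnertonDyer.BirchSwinnertonDyer.Theses.ManinLocalTwoThree
import HarnessLib

/-!
# Manin's conjecture from Stevens' inclusion and the conjugation obstruction: `|c₀| ≤ 2` modulo CDT at EVERY level,
# Mazur 1978 / Abbes–Ullmo 1996 / Česnavičius 2018 as COROLLARIES, and `|c₀| = 1` modulo four printed facts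
(route `ManinLocalTwoThree`, cell bsd-f2-manin, prover seat p3 gen 20; bears on the rung target `ManinConstantOneRung`
stmt-BirchSwinnertonDyer-22445, on C2 stmt-BirchSwinnertonDyer-22967 and on the support items stmt-…-19383 / 20090 / 20091)

THE OBSERVATION.  Let `D₀` be a lattice-optimal `X₀(N)`-datum of a globally minimal `W₀` (`Λ_{W₀} = c₀Λ₀(f)`) and suppose STEVENS'
INCLUSION `Λ₁(f) ⊆ Λ_{W₀}` (E-an-250; a THEOREM modulo CDT, `CDivisionInt.periodLatticeGamma1_le_neron_of_CDTInt`).  Then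
`Λ₁(f) ⊆ c₀Λ₀(f) = |c₀|·Λ₀(f)`, and complex conjugation — trivial on `Λ₀/Λ₁` (LEAD p1 gen 14), of trace `−2` on the lattice — forbids
`Λ₁(f) ⊆ nΛ₀(f)` for every integer `n ≥ 3` (`KummerValues.not_periodLatticeGamma1_le_natCast_mul_periodLattice`, fact-free).  Hence
**`|c₀| ≤ 2` at EVERY level `N`** (the cell's earlier bounds `c₀ ∣ p` needed a traceless `p² ∣ N`, Ling–Oesterlé), i.e. **`p ∤ c₀` for every
`p ≥ 3` modulo CDT ALONE** — uniformly in `p` and `N`: Mazur 1978 Cor 4.1 (odd `p`, `p² ∤ N`), Abbes–Ullmo 1996 Thm A at odd `p ∤ N`, the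
cell's C3 (`9 ∣ N`) and C5 (`p² ∣ N`, `p ≥ 5`) all at once.  The prime `2`: `2 ∣ c₀` puts the datum in the HALF-INDEX world `Λ₁ ⊆ 2Λ₀`,
where THEOREM K's Kummer values (⟸ CES ∧ T-es-75, `halfIndex_kummerValues_of_Tes75_CES`) force `2⁵ ∣ N` (PROPOSITION A) — contradicting
`2 ∤ N` (Abbes–Ullmo at `2`) or `2 ∥ N` (Česnavičius 2018 Thm 1.2) — and, with modularity, the Frey-twist shape against Tate's family C
(`not_halfIndex_of_modularity_CES_Tes75`) at every level: **`|c₀| = 1`, Manin's conjecture for lattice-optimal data, modulo the FOUR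
statement-only printed facts {modularity, CDT, CES, T-es-75}** — the three classical Manin-constant theorems of the route's
`PrintedSemistableManinFacts` are NOT used (they become corollaries).

* §1 fact-free core: `natAbs_maninConstant_le_two_of_gamma1Periods_le`, `not_dvd_maninConstant_of_gamma1Periods_le`,
  `halfIndex_of_gamma1Periods_le_of_two_dvd`.
* §2 modulo CDT: `not_dvd_maninConstant_of_CDT` (`p ≥ 3`, every level), `natAbs_maninConstant_le_two_of_CDT`, `mazur_of_CDT`
  (= the Literature fact `mazur_not_dvd_maninConstant_of_odd`) and the route support item BY NAME `maninLocalTwoThree_mazurManinConstantOddPrimes_of_CDT`.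
* §3 the prime `2` modulo CDT ∧ CES ∧ T-es-75: `two_pow_five_dvd_of_two_dvd_maninConstant`, `abbesUllmo_of_CDT_CES_Tes75`,
  `cesnavicius_of_CDT_CES_Tes75` and the route support items BY NAME.
* §4 `abs_maninConstant_eq_one_of_fourPrintedFacts`, `maninConstantOne_of_fourPrintedFacts : exists_isNewformOf → CDT → CES → T-es-75 →
  Rank1Residual.ManinConstant.ManinConstantOne` and the rung `maninLocalTwoThree_maninConstantOneRung_of_fourPrintedFacts`.

HONEST FRAMING: everything in §2–§4 is CONDITIONAL on statement-only printed facts that are NOT discharged here (Calegari–Dimitrov–Tang 2025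
Thm 1.0.1 = CDT; Conrad–Edixhoven–Stein 2003 §6.1 / Stevens 1989 = CES; Stevens 1982 Thm 1.3.1 (b) = T-es-75; modularity); the items stay OPEN
as filed; Manin's conjecture and BSD are NOT proved.  No definitions, no sorry.
[cite: Manin1972, §1.6] [cite: Stevens1989, §2] [cite: Mazur1978, Cor. 4.1] [cite: AbbesUllmo1996, Thm. A] [cite: Cesnavicius2018, Thm. 1.2]
[cite: CalegariDimitrovTang2025, Thm. 1.0.1] [cite: Stevens1982, §1.3 Thm. 1.3.1 (b)] [cite: ConradEdixhovenStein2003, §6.1 Lemma 6.1.6]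
-/

set_option autoImplicit false
-- lint-debt: the directory name repeats the summit name (sibling precedent `ManinLocalTwoThreeKummerValuesScaledModel.lean`)
set_option linter.dupNamespace false

noncomputable section

open scoped Classical MatrixGroups
open Complex CongruenceSubgroup WeierstrassCurve
open Literature.NumberTheory.EllipticCurves Literature.NumberTheory.EllipticCurves.ModularForms
open Literature.NumberTheory.Automorphic

namespace Summit.BirchSwinnertonDyer.BirchSwinnertonDyer.Theorems.ManinLocalTwoThree.KummerValues

/-! ## §1 Fact-free core: Stevens' inclusion and the lattice clause bound the Manin constant by `2` -/

section Core

variable {W₀ : WeierstrassCurve ℚ} {N : ℕ} [NeZero N] (D₀ : ModularParametrizationData W₀ N)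

/-- **`p ∤ c₀` for every `p ≥ 3`, given the lattice clause and Stevens' inclusion `Λ₁(f) ⊆ Λ_{W₀}`** (fact-free): `p ∣ c₀` would give
`Λ₁(f) ⊆ c₀Λ₀(f) ⊆ pΛ₀(f)`, excluded by the conjugation obstruction. [cite: Stevens1989, §2] [cite: Manin1972, §1.6] -/
theorem not_dvd_maninConstant_of_gamma1Periods_le (hopt : ∀ z ∈ D₀.L.lattice, ∃ w ∈ periodLattice D₀.f, z = D₀.c * w)
    (hSI : ∀ z ∈ periodLatticeGamma1 D₀.f, z ∈ D₀.L.lattice) {p : ℕ} (hp : 3 ≤ p) : ¬ (p : ℤ) ∣ D₀.maninConstant := by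
  rintro ⟨k, hk⟩
  refine not_periodLatticeGamma1_le_natCast_mul_periodLattice D₀ hopt hp fun z hz ↦ ?_
  obtain ⟨w, hw, hzw⟩ := hopt z (hSI z hz)
  refine ⟨(k : ℂ) * w, ?_, ?_⟩
  · rw [← zsmul_eq_mul]; exact (periodLattice D₀.f).zsmul_mem hw k
  · rw [hzw, show (D₀.c : ℂ) = ((D₀.maninConstant : ℤ) : ℂ) from rfl, hk]; push_cast; ring

/-- **`|c₀| ≤ 2` given the lattice clause and Stevens' inclusion** (fact-free; every level `N`). [cite: Stevens1989, §2] [cite: Manin1972, §1.6] -/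
theorem natAbs_maninConstant_le_two_of_gamma1Periods_le (hopt : ∀ z ∈ D₀.L.lattice, ∃ w ∈ periodLattice D₀.f, z = D₀.c * w)
    (hSI : ∀ z ∈ periodLatticeGamma1 D₀.f, z ∈ D₀.L.lattice) : D₀.maninConstant.natAbs ≤ 2 := by
  by_contra h
  exact not_dvd_maninConstant_of_gamma1Periods_le D₀ hopt hSI (p := D₀.maninConstant.natAbs) (by omega) (Int.natAbs_dvd.mpr dvd_rfl)

/-- **`2 ∣ c₀` puts the datum in the half-index world `Λ₁(f) ⊆ 2Λ₀(f)`** (given the lattice clause and Stevens' inclusion; fact-free). [cite: Stevens1989, §2] -/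
theorem halfIndex_of_gamma1Periods_le_of_two_dvd (hopt : ∀ z ∈ D₀.L.lattice, ∃ w ∈ periodLattice D₀.f, z = D₀.c * w)
    (hSI : ∀ z ∈ periodLatticeGamma1 D₀.f, z ∈ D₀.L.lattice) (h2 : (2 : ℤ) ∣ D₀.maninConstant) :
    ∀ z ∈ periodLatticeGamma1 D₀.f, ∃ w ∈ periodLattice D₀.f, z = 2 * w := by
  intro z hz
  obtain ⟨k, hk⟩ := h2
  obtain ⟨w, hw, hzw⟩ := hopt z (hSI z hz)
  refine ⟨(k : ℂ) * w, ?_, ?_⟩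
  · rw [← zsmul_eq_mul]; exact (periodLattice D₀.f).zsmul_mem hw k
  · rw [hzw, show (D₀.c : ℂ) = ((D₀.maninConstant : ℤ) : ℂ) from rfl, hk]; push_cast; ring

end Core

/-! ## §2 Modulo CDT: `p ∤ c₀` for every `p ≥ 3` at every level; Mazur 1978 as a corollary -/

section OddPart

/-- **`p ∤ c₀` for every `p ≥ 3`, at EVERY level, modulo CDT alone** (Stevens' inclusion ⟸ CDT; §1).  Uniform in `p` and `N`: contains the
semistable odd primes (Mazur 1978), the good odd primes (Abbes–Ullmo 1996), `p = 3` with `9 ∣ N` (C3) and `p ≥ 5` with `p² ∣ N` (C5).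
CONDITIONAL on CDT. [cite: CalegariDimitrovTang2025, Thm. 1.0.1] [cite: Stevens1989, §2] [cite: Manin1972, §1.6] -/
theorem not_dvd_maninConstant_of_CDT (hCDT : CalegariDimitrovTang2025_unboundedDenominators) (W₀ : WeierstrassCurve ℚ) [W₀.IsElliptic] [W₀.IsGloballyMinimal] {N : ℕ} [NeZero N]
    (D₀ : ModularParametrizationData W₀ N) (hopt : ∀ z ∈ D₀.L.lattice, ∃ w ∈ periodLattice D₀.f, z = D₀.c * w) {p : ℕ} (hp : 3 ≤ p) :
    ¬ (p : ℤ) ∣ D₀.maninConstant :=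
  not_dvd_maninConstant_of_gamma1Periods_le D₀ hopt (CDivisionInt.periodLatticeGamma1_le_neron_of_CDTInt hCDT D₀) hp

/-- **`|c₀| ≤ 2` at EVERY level, modulo CDT.** CONDITIONAL. [cite: CalegariDimitrovTang2025, Thm. 1.0.1] [cite: Stevens1989, §2] -/
theorem natAbs_maninConstant_le_two_of_CDT (hCDT : CalegariDimitrovTang2025_unboundedDenominators) (W₀ : WeierstrassCurve ℚ) [W₀.IsElliptic] [W₀.IsGloballyMinimal] {N : ℕ} [NeZero N]
    (D₀ : ModularParametrizationData W₀ N) (hopt : ∀ z ∈ D₀.L.lattice, ∃ w ∈ periodLattice D₀.f, z = D₀.c * w) :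
    D₀.maninConstant.natAbs ≤ 2 :=
  natAbs_maninConstant_le_two_of_gamma1Periods_le D₀ hopt (CDivisionInt.periodLatticeGamma1_le_neron_of_CDTInt hCDT D₀)

/-- **Mazur 1978 Cor 4.1 (`p ∤ c₀` for odd `p` with `p² ∤ N`) ⟸ CDT** — the Literature fact `mazur_not_dvd_maninConstant_of_odd` as a
COROLLARY (its level hypothesis is not even used).  CONDITIONAL on CDT. [cite: Mazur1978, Cor. 4.1] [cite: CalegariDimitrovTang2025, Thm. 1.0.1] -/
theorem mazur_of_CDT (hCDT : CalegariDimitrovTang2025_unboundedDenominators) : mazur_not_dvd_maninConstant_of_odd := by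
  intro W' _ _ N' _ D' hopt p hp hp2 _
  exact not_dvd_maninConstant_of_CDT hCDT W' D' hopt (by have := hp.two_le; omega)

/-- **The route's support item `MazurManinConstantOddPrimes` (stmt-BirchSwinnertonDyer-19383) BY NAME ⟸ CDT.** CONDITIONAL; the item stays open
as filed. [cite: Mazur1978, Cor. 4.1] [cite: CalegariDimitrovTang2025, Thm. 1.0.1] -/
theorem maninLocalTwoThree_mazurManinConstantOddPrimes_of_CDT (hCDT : CalegariDimitrovTang2025_unboundedDenominators) :
    Summit.BirchSwinnertonDyer.BirchSwinnertonDyer.Theses.ManinLocalTwoThree.MazurManinConstantOddPrimes :=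
  mazur_of_CDT hCDT

end OddPart

/-! ## §3 The prime `2` modulo CDT ∧ CES ∧ T-es-75: Abbes–Ullmo at `2` and Česnavičius 2018 as corollaries -/

section Two

/-- **`2 ∣ c₀ ⟹ 2⁵ ∣ N`**, modulo CDT ∧ CES ∧ T-es-75: `2 ∣ c₀` gives the half-index configuration (§1), THEOREM K's Kummer values there
(`halfIndex_kummerValues_of_Tes75_CES`), and PROPOSITION A (`two_pow_five_dvd_of_halfIndex_of_kummerValues`).  CONDITIONAL.
[cite: CalegariDimitrovTang2025, Thm. 1.0.1] [cite: Stevens1982, §1.3 Thm. 1.3.1 (b)] [cite: ConradEdixhovenStein2003, §6.1 Lemma 6.1.6] -/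
theorem two_pow_five_dvd_of_two_dvd_maninConstant (hCDT : CalegariDimitrovTang2025_unboundedDenominators) (hCES : exists_optimal_gamma1ParametrizationData)
    (hSt : optimalGamma1Parametrization_cuspInv_galoisAction) (W₀ : WeierstrassCurve ℚ) [W₀.IsElliptic] [W₀.IsGloballyMinimal] {N : ℕ} [NeZero N]
    (D₀ : ModularParametrizationData W₀ N) (hopt : ∀ z ∈ D₀.L.lattice, ∃ w ∈ periodLattice D₀.f, z = D₀.c * w)
    (h2 : (2 : ℤ) ∣ D₀.maninConstant) : 2 ^ 5 ∣ N := by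
  have hhalf := halfIndex_of_gamma1Periods_le_of_two_dvd D₀ hopt (CDivisionInt.periodLatticeGamma1_le_neron_of_CDTInt hCDT D₀) h2
  exact two_pow_five_dvd_of_halfIndex_of_kummerValues W₀ D₀ hopt hhalf
    (halfIndex_kummerValues_of_Tes75_CES hSt hCES W₀ D₀ hopt hhalf)

/-- **Abbes–Ullmo 1996 Thm A (`p ∤ N ⟹ p ∤ c₀`) ⟸ CDT ∧ CES ∧ T-es-75** — odd `p` by §2, `p = 2 ∤ N` against `2⁵ ∣ N`.  CONDITIONAL.
[cite: AbbesUllmo1996, Thm. A] [cite: CalegariDimitrovTang2025, Thm. 1.0.1] [cite: Stevens1982, §1.3 Thm. 1.3.1 (b)] -/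
theorem abbesUllmo_of_CDT_CES_Tes75 (hCDT : CalegariDimitrovTang2025_unboundedDenominators) (hCES : exists_optimal_gamma1ParametrizationData)
    (hSt : optimalGamma1Parametrization_cuspInv_galoisAction) :
    abbesUllmo_not_dvd_maninConstant_of_not_dvd_level := by
  intro W' _ _ N' _ D' hopt p hp hpN
  rcases hp.eq_two_or_odd' with rfl | hodd
  · intro h2
    exact hpN ((dvd_pow_self 2 (by norm_num)).trans (two_pow_five_dvd_of_two_dvd_maninConstant hCDT hCES hSt W' D' hopt (by exact_mod_cast h2)))
  · obtain ⟨k, hk⟩ := hodd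
    exact not_dvd_maninConstant_of_CDT hCDT W' D' hopt (by have := hp.two_le; omega)

/-- **Česnavičius 2018 Thm 1.2 (`2 ∥ N ⟹ 2 ∤ c₀`) ⟸ CDT ∧ CES ∧ T-es-75** (`2 ∣ c₀ ⟹ 2⁵ ∣ N` against `4 ∤ N`).  CONDITIONAL.
[cite: Cesnavicius2018, Thm. 1.2] [cite: CalegariDimitrovTang2025, Thm. 1.0.1] [cite: Stevens1982, §1.3 Thm. 1.3.1 (b)] -/
theorem cesnavicius_of_CDT_CES_Tes75 (hCDT : CalegariDimitrovTang2025_unboundedDenominators) (hCES : exists_optimal_gamma1ParametrizationData)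
    (hSt : optimalGamma1Parametrization_cuspInv_galoisAction) :
    cesnavicius_not_two_dvd_maninConstant_of_two_dvd_level := by
  intro W' _ _ N' _ D' hopt _ h4 h2
  exact h4 ((pow_dvd_pow 2 (by norm_num : 2 ≤ 5)).trans (two_pow_five_dvd_of_two_dvd_maninConstant hCDT hCES hSt W' D' hopt h2))

/-- **The route's support item `AbbesUllmoManinConstantGoodPrimes` (stmt-BirchSwinnertonDyer-20090) BY NAME ⟸ CDT ∧ CES ∧ T-es-75.** CONDITIONAL.
[cite: AbbesUllmo1996, Thm. A] -/
theorem maninLocalTwoThree_abbesUllmoManinConstantGoodPrimes_of_CDT_CES_Tes75 (hCDT : CalegariDimitrovTang2025_unboundedDenominators) (hCES : exists_optimal_gamma1ParametrizationData)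
    (hSt : optimalGamma1Parametrization_cuspInv_galoisAction) :
    Summit.BirchSwinnertonDyer.BirchSwinnertonDyer.Theses.ManinLocalTwoThree.AbbesUllmoManinConstantGoodPrimes :=
  abbesUllmo_of_CDT_CES_Tes75 hCDT hCES hSt

/-- **The route's support item `CesnaviciusManinConstantAtTwo` (stmt-BirchSwinnertonDyer-20091) BY NAME ⟸ CDT ∧ CES ∧ T-es-75.** CONDITIONAL.
[cite: Cesnavicius2018, Thm. 1.2] -/
theorem maninLocalTwoThree_cesnaviciusManinConstantAtTwo_of_CDT_CES_Tes75 (hCDT : CalegariDimitrovTang2025_unboundedDenominators) (hCES : exists_optimal_gamma1ParametrizationData)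
    (hSt : optimalGamma1Parametrization_cuspInv_galoisAction) :
    Summit.BirchSwinnertonDyer.BirchSwinnertonDyer.Theses.ManinLocalTwoThree.CesnaviciusManinConstantAtTwo :=
  cesnavicius_of_CDT_CES_Tes75 hCDT hCES hSt

end Two

/-! ## §4 Manin's conjecture `|c₀| = 1` modulo the four printed facts {modularity, CDT, CES, T-es-75} -/

section Manin

/-- **`|c₀| = 1` for every lattice-optimal `X₀(N)`-datum of every globally minimal curve, modulo {modularity, CDT, CES, T-es-75}**: `|c₀| ≤ 2` (§2);
`|c₀| = 2` would put the datum in the half-index world (§1), impossible modulo modularity ∧ CES ∧ T-es-75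
(`not_halfIndex_of_modularity_CES_Tes75`).  Mazur 1978, Abbes–Ullmo 1996, Česnavičius 2018 are NOT used.  CONDITIONAL; Manin's conjecture is NOT
proved unconditionally; BSD is not proved. [cite: CalegariDimitrovTang2025, Thm. 1.0.1] [cite: Stevens1982, §1.3 Thm. 1.3.1 (b)]
[cite: ConradEdixhovenStein2003, §6.1 Lemma 6.1.6] [cite: Manin1972, §1.6] -/
theorem abs_maninConstant_eq_one_of_fourPrintedFacts (hnf : exists_isNewformOf) (hCDT : CalegariDimitrovTang2025_unboundedDenominators)
    (hCES : exists_optimal_gamma1ParametrizationData) (hSt : optimalGamma1Parametrization_cuspInv_galoisAction) (W₀ : WeierstrassCurve ℚ) [W₀.IsElliptic] [W₀.IsGloballyMinimal] {N : ℕ} [NeZero N]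
    (D₀ : ModularParametrizationData W₀ N) (hopt : ∀ z ∈ D₀.L.lattice, ∃ w ∈ periodLattice D₀.f, z = D₀.c * w) :
    |D₀.maninConstant| = 1 := by
  have hSI := CDivisionInt.periodLatticeGamma1_le_neron_of_CDTInt hCDT D₀
  have hle := natAbs_maninConstant_le_two_of_gamma1Periods_le D₀ hopt hSI
  have hne : D₀.maninConstant ≠ 0 := D₀.maninConstant_ne_zero_holds
  have hne2 : D₀.maninConstant.natAbs ≠ 2 := fun h2 ↦
    not_halfIndex_of_modularity_CES_Tes75 hnf hCES hSt W₀ D₀ hopt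
      (halfIndex_of_gamma1Periods_le_of_two_dvd D₀ hopt hSI (Int.natAbs_dvd_natAbs.mp (by rw [h2]; decide)))
  have h1 : D₀.maninConstant.natAbs = 1 := by
    have h0 : D₀.maninConstant.natAbs ≠ 0 := Int.natAbs_ne_zero.mpr hne
    omega
  rw [Int.abs_eq_natAbs, h1, Nat.cast_one]

/-- **Manin's conjecture leaf `ManinConstantOne` ⟸ FOUR printed facts {modularity, CDT, CES, T-es-75}** (the route's rung through the
conjugation obstruction; the three classical Manin-constant theorems of `PrintedSemistableManinFacts` are not needed).  CONDITIONAL on four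
statement-only facts, none discharged; Manin's conjecture and BSD are NOT proved. [cite: CalegariDimitrovTang2025, Thm. 1.0.1]
[cite: Stevens1982, §1.3 Thm. 1.3.1 (b)] [cite: ConradEdixhovenStein2003, §6.1 Lemma 6.1.6] -/
theorem maninConstantOne_of_fourPrintedFacts (hnf : exists_isNewformOf) (hCDT : CalegariDimitrovTang2025_unboundedDenominators)
    (hCES : exists_optimal_gamma1ParametrizationData) (hSt : optimalGamma1Parametrization_cuspInv_galoisAction) :
    Summit.BirchSwinnertonDyer.Rank1Residual.ManinConstant.ManinConstantOne :=
  fun W₀ _ _ _ _ D₀ hopt ↦ abs_maninConstant_eq_one_of_fourPrintedFacts hnf hCDT hCES hSt W₀ D₀ hopt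

/-- **The route's rung target `ManinConstantOneRung` (stmt-BirchSwinnertonDyer-22445) BY NAME ⟸ {modularity, CDT, CES, T-es-75}.** CONDITIONAL;
the item stays open as filed. [cite: CalegariDimitrovTang2025, Thm. 1.0.1] [cite: Stevens1982, §1.3 Thm. 1.3.1 (b)] -/
theorem maninLocalTwoThree_maninConstantOneRung_of_fourPrintedFacts (hnf : exists_isNewformOf) (hCDT : CalegariDimitrovTang2025_unboundedDenominators)
    (hCES : exists_optimal_gamma1ParametrizationData) (hSt : optimalGamma1Parametrization_cuspInv_galoisAction) :
    Summit.BirchSwinnertonDyer.BirchSwinnertonDyer.Theses.ManinLocalTwoThree.ManinConstantOneRung :=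
  fun W₀ _ _ _ _ D₀ hopt ↦ abs_maninConstant_eq_one_of_fourPrintedFacts hnf hCDT hCES hSt W₀ D₀ hopt

end Manin

end Summit.BirchSwinnertonDyer.BirchSwinnertonDyer.Theorems.ManinLocalTwoThree.KummerValues

end
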